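import Literature.AnabelianGeometry.EtaleTheta.TemperedFrobenioidOfThetaTwistTower
import Literature.AnabelianGeometry.EtaleTheta.BiKummerOfModel
import Literature.AnabelianGeometry.EtaleTheta.Discharge.Sec3PhiRIntegralWeak
import Literature.AnabelianGeometry.EtaleTheta.Discharge.Sec5ConstantsDictionaryNoCountableCarrier
import Literature.AlgebraicGeometry.Frobenioids.MonoidFunctorsOnD

/-!
# [EtTh] §5 ↔ §3: the tower carriers of record have COUNTABLY many birational units — so the dictionary binder `hD` is unproducible there (Def. 3.3 (iii) p.299, Def. 3.6 (i)(ii) pp.302–303, Lemma 5.8 p.331 / PDF pp.73, 76–77, 105)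

S. Mochizuki, *The étale theta function and its Frobenioid-theoretic manifestations*, Publ. RIMS **45** (2009) [MochizukiEtTh2009],
Def. 3.3 (iii) p.299 (PDF p.73) («`B₀(Y^log) = lim Mero(Z^log_∞)^{Gal(Z^log_∞/Y^log)}`», the Galois-invariant log-meromorphic functions),
Def. 3.6 (i)(ii) pp.302–303 (PDF pp.76–77) (the data `(D, Φ, B, B → Φ^gp)` with `B := B₀^Λ|_D ×_{(Φ^{ℝ-log})^gp} Φ^gp`), Lemma 5.8
p.331 (PDF p.105) ("the natural inclusion `K^× ↪ O^×(B_N^birat)`").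
[cite: MochizukiEtTh2009, Def 3.6 (i)(ii) pp.302–303 (PDF pp.76–77); Lem 5.8 p.331 (PDF p.105)]

abc-iut cell, layer L2 = [EtTh], seat abc-iut-L2-t11 (gen 10); abc-iut-L2-lead R1155 «GO HD-NOGO@FILE4».  PROOF-ONLY (0 definitions, no
instance / notation / `Prop` fact); nothing landed is edited or restated.  Consumed BY NAME: abc-iut-L2-t3's `LogDivisorTower`,
`DivisorMonoids.ofTower`, `RealifiedDivisorMonoids.ofRlfZWeak`, `TemperedFrobenioid` (`ratFn`, `ΦgpToRlog`, `biratUnitsModel`);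
abc-iut-w6-d058's `LogDivisorModel.GaloisAction.bZero` / `isConnectedGSet`; abc-iut-w5-d135 / abc-iut-L2-d2's cancellativity of
`Φ₀^ℝ` over the weak vocabulary (`isCancelMul_ΦRlog_weak`, `isCancelMul_divisorMonoid_weak'`); [FrdI] `gpMap_injective`; abc-iut-L2-d2's
2c FILE 4 `ThetaTwistTowerTempered.temperedFrobenioid` (p493549) as the NAMED INSTANCE; this seat's no-go
`ThetaFrobenioid.BiratAutAction.not_exists_constantsDictionary_of_countable_biratUnits` (p497045).

WHAT IS PROVED.
* `LogDivisorModel.GaloisAction.bZero_ext_of_isConnectedGSet` / `countable_bZero_of_isConnectedGSet` — on a CONNECTED `G`-set `S` (one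
  orbit) a `G`-equivariant family `S → Fn` is determined by ONE value, so `B₀(S) = Hom_G(S, Mero)` embeds in `Fn` and is countable when the
  function group `Fn` is (Def. 3.3 (iii): the invariants of ONE covering `Z_∞`).
* `TemperedFrobenioid.ΦgpToRlog_injective_weak` — for EVERY tempered Frobenioid over the weak [FrdI] vocabulary the comparison
  `Φ(A)^gp → (Φ^{ℝ-log})^gp(A)` is injective (both monoids cancellative); hence `ratFn_ext_fst_weak`: an element of
  `B(A) = B₀^Λ(Y_A) ×_{(Φ^{ℝ-log})^gp} Φ(A)^gp` is determined by its FUNCTION component, and `countable_ratFn_weak` /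
  `countable_biratUnitsModel_weak`: `B(A)` and `O^×(A^birat) = B(A_D)^×` are countable as soon as `B₀^Λ(Y_A)` is.
* `LogDivisorTower.countable_BZero_obj` + `TemperedFrobenioid.countable_biratUnitsModel_ofTower` — for EVERY v2 tower `T` whose level
  function groups `(T.Z i).Fn` are countable and EVERY tempered Frobenioid over `ofRlfZWeak (ofTower T) hpf` (any base category, any
  vocabulary), `O^×(A^birat)` is COUNTABLE at every object.
* NAMED INSTANCE `ThetaTwistTowerTempered.countable_biratUnitsModel_temperedFrobenioid`: abc-iut-L2-d2's FILE 4 carrier (the ε-free (β)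
  theta tower `towerC₃sf`, levels `epsKer ≤ μ_{N_n} × μ₂ × ℤ³`) has countably many birational units at every object.
* COMPOSITION WITH p497045, junction-free (abc-iut-L2-t3's finding F-L2t3g8-1 «base mismatch» respected — no literal junction term over
  `B^temp(Π^tp_X̲̲)⁰` is formed): `not_exists_constantsDictionary_of_biratUnits_equiv_towerCarrier` /
  `…_equiv_thetaTwistTower` — ANY §5 datum `𝔉` whose `O^×(B_N^birat)` is in bijection with such a `B(A_D)^×` admits NO constants
  subgroup / reading `(Cst, ν̃)` satisfying `ConstantsDictionary`, whatever `α, ι, m` (abc-iut-L2-lead R1155: class J′ «carrier-blocked»,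
  BY NAME at the carriers of record).
HONEST FRAMING: kernel facts about OUR model class; the tempered Frobenioid of an actual Tate curve (uncountable function field) is not in
the tree; nothing of [EtTh] is asserted or denied; no side is taken on [IUTchIII] Cor. 3.12; typed ≠ proved.
-/

noncomputable section

namespace Literature.AnabelianGeometry.EtaleTheta

open CategoryTheory Opposite Function Literature.AlgebraicGeometry.Frobenioids Literature.AnabelianGeometry.SemiGraphs

universe u₀ v₀ u v w u' v'

/-! ### `B₀` of a connected `G`-set embeds in the function group -/

namespace LogDivisorModel.GaloisAction

variable {Z : LogDivisorModel.{u}} {G : Type u} [Group G] (A : Z.GaloisAction G) {S : Action (Type u) G}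

/-- On a CONNECTED `G`-set (one orbit) a `G`-equivariant family of functions is determined by its value at ONE point
(`b(g·s₀) = g·b(s₀)`): Def. 3.3 (iii)'s `B₀(Y) = Mero(Z_∞)^{Gal(Z_∞/Y)}` read inside `Mero(Z_∞)`.  [cite: MochizukiEtTh2009, Def 3.3 (iii) p.299 (PDF p.73)] -/
theorem bZero_ext_of_isConnectedGSet (hS : isConnectedGSet S) (s₀ : S.V) {b c : A.bZero S} (h : b.1 s₀ = c.1 s₀) : b = c := by
  refine Subtype.ext (funext fun t => ?_)
  obtain ⟨g, rfl⟩ := hS.2 s₀ t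
  rw [b.2.2, c.2.2, h]

/-- Hence `B₀(S)` of a connected `G`-set is COUNTABLE whenever the function group `Mero(Z_∞) = Fn` is.
[cite: MochizukiEtTh2009, Def 3.3 (iii) p.299 (PDF p.73)] -/
theorem countable_bZero_of_isConnectedGSet [Countable Z.Fn] (hS : isConnectedGSet S) : Countable (A.bZero S) := by
  obtain ⟨s₀⟩ := hS.1
  exact Function.Injective.countable (f := fun b : A.bZero S => b.1 s₀) fun b c h => A.bZero_ext_of_isConnectedGSet hS s₀ h

end LogDivisorModel.GaloisAction

/-! ### `B(A)` is determined by its function component; countability over the weak vocabulary -/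

namespace TemperedFrobenioid

section Weak

variable {D₀ : Type u₀} [Category.{v₀} D₀] {T : RealifiedDivisorMonoids (D₀ := D₀) treeMonoidVocabWeak.{w}}
  {D : Type u} [Category.{v} D] {VD : FrdICatStub.{u, v, w} D} (C : TemperedFrobenioid T D VD)

/-- **`Φ(A)^gp → (Φ^{ℝ-log})^gp(A)` is injective** for every tempered Frobenioid over the weak [FrdI] vocabulary: `Φ(A) ⊆ Φ^{ℝ-log}(A) = Φ₀^ℝ(Y_A)`
are both cancellative (`isCancelMul_divisorMonoid_weak'`, `isCancelMul_ΦRlog_weak`), and the groupification of an injective homomorphism of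
cancellative monoids is injective ([FrdI] Def. 1.1 (ii), `gpMap_injective`).  [cite: MochizukiEtTh2009, Def 3.6 (ii) p.303 (PDF p.77)] -/
theorem ΦgpToRlog_injective_weak (A : Dᵒᵖ) : Injective (C.ΦgpToRlog A) := by
  haveI : IsCancelMul (T.ΦR.obj (C.baseOp A)) := T.isCancelMul_ΦR_weak (C.baseOp A)
  haveI : IsCancelMul (C.Φ.carrier A) := C.isCancelMul_divisorMonoid_weak' A
  exact gpMap_injective _ Subtype.val_injective

/-- **An element of `B(A) = B₀^Λ(Y_A) ×_{(Φ^{ℝ-log})^gp} Φ(A)^gp` is determined by its function component** (its divisor component is the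
unique preimage of `div(b)` under the injective comparison).  [cite: MochizukiEtTh2009, Def 3.6 (ii) p.303 (PDF p.77)] -/
theorem ratFn_ext_fst_weak (A : Dᵒᵖ) {p q : C.ratFn A} (h : p.1.1 = q.1.1) : p = q := by
  have hp : T.divΛ (C.baseOp A) p.1.1 = C.ΦgpToRlog A p.1.2 := p.2
  have hq : T.divΛ (C.baseOp A) q.1.1 = C.ΦgpToRlog A q.1.2 := q.2
  have h2 : p.1.2 = q.1.2 := C.ΦgpToRlog_injective_weak A (by rw [← hp, ← hq, h])
  exact Subtype.ext (Prod.ext h h2)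

/-- **`B(A)` is countable when `B₀^Λ(Y_A)` is** (weak vocabulary). [cite: MochizukiEtTh2009, Def 3.6 (ii) p.303 (PDF p.77)] -/
theorem countable_ratFn_weak (A : Dᵒᵖ) [Countable (T.BΛ.obj (C.baseOp A))] : Countable (C.ratFn A) :=
  Function.Injective.countable (f := fun p : C.ratFn A => p.1.1) fun _ _ h => C.ratFn_ext_fst_weak A h

/-- The same for the value `B(A)` of the rational-function functor. [cite: MochizukiEtTh2009, Def 3.6 (ii) p.303 (PDF p.77)] -/
theorem countable_ratFnFunctor_obj_weak (A : Dᵒᵖ) [Countable (T.BΛ.obj (C.baseOp A))] : Countable (C.ratFnFunctor.obj A) :=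
  C.countable_ratFn_weak A

/-- **`O^×(A^birat) = B(A_D)^×` is countable when `B₀^Λ(A_D)` is** (weak vocabulary), for every object `A` of the tempered Frobenioid.
[cite: MochizukiEtTh2009, Def 4.1 p.312 (PDF p.86)] -/
theorem countable_biratUnitsModel_weak (X : C.category) [Countable (T.BΛ.obj (C.baseOp (op X.base)))] :
    Countable (C.biratUnitsModel X) := by
  haveI : Countable (C.ratFnFunctor.obj (op X.base)) := C.countable_ratFnFunctor_obj_weak (op X.base)
  exact Function.Injective.countable (Units.val_injective (α := C.ratFnFunctor.obj (op X.base)))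

end Weak

end TemperedFrobenioid

/-! ### Every v2 tower with countable level function groups -/

namespace LogDivisorTower

variable {P : Type u} [Group P] [TopologicalSpace P] {L : LevelSystem P} (T : LogDivisorTower P L)

/-- **`B₀(Y)` of a v2 tower is countable at every connected tempered covering `Y`** when the tower's level function groups are: `Y` is ONE
orbit ([FrdII] Ex. 1.3, `isConnectedGSet_temperedInclusion`) and `B₀(Y) ↪ Mero(Z_∞^{(lvl Y)})`.  [cite: MochizukiEtTh2009, Def 3.3 (iii) p.299 (PDF p.73)] -/
theorem countable_BZero_obj [hF : ∀ i, Countable (T.Z i).Fn] (Y : (ConnectedPart (BTemp P))ᵒᵖ) : Countable (T.BZero.obj Y) := by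
  have hS : LogDivisorModel.GaloisAction.isConnectedGSet (gset Y.unop) := by
    have h := LogDivisorModel.GaloisAction.isConnectedGSet_temperedInclusion (Γ := P) Y.unop
    rwa [LogDivisorModel.GaloisAction.temperedInclusion_obj] at h
  haveI := hF (L.lvl Y.unop)
  exact (T.act (L.lvl Y.unop)).countable_bZero_of_isConnectedGSet hS

end LogDivisorTower

namespace TemperedFrobenioid

section OfTower

variable {P : Type u} [Group P] [TopologicalSpace P] {L : LevelSystem P} (T : LogDivisorTower P L)
  (hpf : ∀ Y : (ConnectedPart (BTemp P))ᵒᵖ, IsPerfFactorialCof ((DivisorMonoids.ofTower T).Φ₀.obj Y))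
  {D : Type u'} [Category.{v'} D] {VD : FrdICatStub.{u', v', u} D}

/-- **For EVERY v2 tower `T` with countable level function groups and EVERY tempered Frobenioid over the weak `Λ = ℤ` data
`ofRlfZWeak (ofTower T) hpf` (any base, any vocabulary), the birational unit group `O^×(A^birat) = B(A_D)^×` is COUNTABLE at every object**
— the carriers of record of the abc-iut towers (ℤ-tower, Kummer–Tate, `ζ`-twist, (β) theta towers) all have finitely generated / finite-by-ℤ^k
level function groups.  [cite: MochizukiEtTh2009, Def 3.6 (i)(ii) pp.302–303 (PDF pp.76–77)] -/
theorem countable_biratUnitsModel_ofTower [∀ i, Countable (T.Z i).Fn]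
    (C : TemperedFrobenioid (RealifiedDivisorMonoids.ofRlfZWeak (DivisorMonoids.ofTower T) hpf) D VD) (X : C.category) :
    Countable (C.biratUnitsModel X) := by
  haveI : Countable ((RealifiedDivisorMonoids.ofRlfZWeak (DivisorMonoids.ofTower T) hpf).BΛ.obj (C.baseOp (op X.base))) :=
    T.countable_BZero_obj (C.baseOp (op X.base))
  exact C.countable_biratUnitsModel_weak X

end OfTower

end TemperedFrobenioid

/-! ### The named instance: abc-iut-L2-d2's 2c FILE 4 carrier over the ε-free (β) theta tower -/

namespace ThetaTwistTowerTempered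

open LogDivisorModel.TateTowerThetaTwist TateTowerKummerTwistRShear

/-- `ZMod n` is countable (`ℤ` or a finite type). [folklore] -/
private theorem countable_zmod (n : ℕ) : Countable (ZMod n) := by
  cases n with
  | zero => exact inferInstanceAs (Countable ℤ)
  | succ n => exact inferInstanceAs (Countable (Fin (n + 1)))

/-- The level function groups of the ε-free (β) theta tower `towerC₃sf` — `epsKer ≤ μ_{N_n} × (μ₂ × ⟨ϖ̈_n⟩ × ⟨Ü_n⟩ × ⟨Θ̈_n⟩)` — are countable.
[cite: MochizukiEtTh2009, Def 3.1 (ii) p.296 (PDF p.70)] -/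
theorem countable_fn_towerC₃sf (n : ℕ) : Countable (towerC₃sf.Z n).Fn := by
  haveI : Countable (ZMod (TateTowerKummerTwist.N n : ℕ)) := countable_zmod _
  haveI : Countable (ZMod 2) := countable_zmod 2
  haveI : Countable (TateTowerKummerTwist.MuN n) :=
    inferInstanceAs (Countable (ZMod (TateTowerKummerTwist.N n : ℕ)))
  haveI : Countable LogDivisorModel.TateTowerTheta.model.Fn :=
    inferInstanceAs (Countable (ZMod 2 × ℤ × ℤ × ℤ))
  haveI : Countable (LogDivisorModel.TateTowerThetaTwist.model (TateTowerKummerTwist.MuN n)).Fn :=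
    inferInstanceAs (Countable (TateTowerKummerTwist.MuN n × LogDivisorModel.TateTowerTheta.model.Fn))
  rw [towerC₃sf_Z]
  exact Subtype.countable

variable (R S : ((ConnectedPart (BTemp (Compat 3 thetaShear)))ᵒᵖ ⥤ CommMonCat.{0}) → Prop)

/-- **NAMED INSTANCE (abc-iut-L2-d2's 2c FILE 4, p493549): the tempered Frobenioid `temperedFrobenioid R S` over the ε-free (β) theta tower
has COUNTABLY many birational units `O^×(A^birat) = B(A_D)^×` at every object `A`** — for every vocabulary choice `R`, `S`.
[cite: MochizukiEtTh2009, Def 3.6 (i)(ii) pp.302–303 (PDF pp.76–77)] -/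
theorem countable_biratUnitsModel_temperedFrobenioid (X : (temperedFrobenioid R S).category) :
    Countable ((temperedFrobenioid R S).biratUnitsModel X) := by
  haveI : ∀ n, Countable (towerC₃sf.Z n).Fn := countable_fn_towerC₃sf
  exact TemperedFrobenioid.countable_biratUnitsModel_ofTower towerC₃sf hpf (temperedFrobenioid R S) X

end ThetaTwistTowerTempered

/-! ### Composition with the no-go of p497045: no dictionary on a §5 datum carried by a tower -/

namespace ThetaFrobenioid

namespace BiratAutAction

variable {C₀ : Type u'} [Category.{0} C₀] {B₀ : Type v'} [Category.{v₀} B₀] {𝔉 : ThetaFrobenioid.{w} C₀ B₀}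
  (α : 𝔉.BiratAutAction) {p : ℕ} [Fact p.Prime] {D : ThetaSetting p} {E : D.EtaleThetaData} {l : ℕ}
  (Cu : E.DoubleUnderline l) (μ : D.CyclotomeMod l 𝔉.N) (hC : D.Compat) (hS : D.Sec2Hyps)
  (ι : 𝔉.PiX ≃ₜ* (Cu.thetaEnvData μ hC hS).PiX) (m : 𝔉.muTorsion 𝔉.BN 𝔉.N ≃* (Cu.thetaEnvData μ hC hS).mu)

/-- **No constants dictionary on a §5 datum whose birational units come from a tower carrier.**  If `O^×(B_N^birat)` of the §5 datum `𝔉`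
is in bijection with `O^×(A^birat) = B(A_D)^×` of a tempered Frobenioid over the weak `Λ = ℤ` data of a v2 tower with countable level
function groups (as it is for every §5 datum assembled from such a carrier — the junction constructors COPY the carrier's birational units),
then NO pair (constants subgroup, reading) satisfies `ConstantsDictionary` — whatever `α, ι, m` (p497045: a dictionary forces
`𝔉.K^× ≃ K^× ⊇ ℚ_p^×`, uncountable).  [cite: MochizukiEtTh2009, Lem 5.8 p.331 (PDF p.105)] -/
theorem not_exists_constantsDictionary_of_biratUnits_equiv_towerCarrier
    {P : Type u} [Group P] [TopologicalSpace P] {L : LevelSystem P} (T : LogDivisorTower P L) [∀ i, Countable (T.Z i).Fn]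
    (hpf : ∀ Y : (ConnectedPart (BTemp P))ᵒᵖ, IsPerfFactorialCof ((DivisorMonoids.ofTower T).Φ₀.obj Y))
    {D' : Type u₀} [Category.{v} D'] {VD : FrdICatStub.{u₀, v, u} D'}
    (C : TemperedFrobenioid (RealifiedDivisorMonoids.ofRlfZWeak (DivisorMonoids.ofTower T) hpf) D' VD) (X : C.category)
    (e : 𝔉.biratUnits 𝔉.BN ≃ C.biratUnitsModel X) :
    ¬ ∃ (Cst : Subgroup (𝔉.biratUnits 𝔉.BN)) (ν' : Cst →* (PadicAlgCl p)ˣ), ConstantsDictionary α Cu μ hC hS ι m Cst ν' := by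
  haveI := C.countable_biratUnitsModel_ofTower T hpf X
  haveI : Countable (𝔉.biratUnits 𝔉.BN) := Countable.of_equiv _ e.symm
  exact not_exists_constantsDictionary_of_countable_biratUnits α Cu μ hC hS ι m

/-- **The named instance**: no constants dictionary on any §5 datum whose birational units are in bijection with those of an object of
abc-iut-L2-d2's FILE 4 carrier `ThetaTwistTowerTempered.temperedFrobenioid R S` (the ε-free (β) theta tower of record).
[cite: MochizukiEtTh2009, Lem 5.8 p.331 (PDF p.105)] -/
theorem not_exists_constantsDictionary_of_biratUnits_equiv_thetaTwistTower
    (R S : ((ConnectedPart (BTemp (TateTowerKummerTwistRShear.Compat 3 TateTowerKummerTwistRShear.thetaShear)))ᵒᵖ ⥤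
      CommMonCat.{0}) → Prop)
    (X : (ThetaTwistTowerTempered.temperedFrobenioid R S).category)
    (e : 𝔉.biratUnits 𝔉.BN ≃ (ThetaTwistTowerTempered.temperedFrobenioid R S).biratUnitsModel X) :
    ¬ ∃ (Cst : Subgroup (𝔉.biratUnits 𝔉.BN)) (ν' : Cst →* (PadicAlgCl p)ˣ), ConstantsDictionary α Cu μ hC hS ι m Cst ν' := by
  haveI := ThetaTwistTowerTempered.countable_biratUnitsModel_temperedFrobenioid R S X
  haveI : Countable (𝔉.biratUnits 𝔉.BN) := Countable.of_equiv _ e.symm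
  exact not_exists_constantsDictionary_of_countable_biratUnits α Cu μ hC hS ι m

end BiratAutAction

end ThetaFrobenioid

end Literature.AnabelianGeometry.EtaleTheta

end
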